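import Literature.IUT.LogVolume.TensorPacketBaseExtensionRetraction
import Mathlib.RingTheory.Trace.Basic
import Mathlib.NumberTheory.Padics.Complex
import HarnessLib

/-!
# The normalised trace is a lattice retraction of an embedding of `p`-adic fields (`p ∤` the degree, tame);
# item (X) of the G1-Θ memo UNCONDITIONALLY at such factors

abc-iut cell, prover seat abc-iut-w5-d036 (gen 5); sequel to `TensorPacketBaseExtensionRetraction` (factorwise
`ℚ_p`-linear retractions `r_i` of the embeddings `σ_i : k_i → k'_i` mapping log-units to log-units ⇒ item (X)).
HERE such retractions are CONSTRUCTED in the classical case: `r := [k':k]⁻¹·Tr_{k'/k}`.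

* `norm_trace_le` — **`‖Tr_{k'/k}(y)‖ ≤ ‖y‖`** for an embedding `σ : k → k'` of `p`-adic fields (the trace is the
  sum of the conjugates `τ(y)` over the `k`-embeddings `τ : k' → ℚ̄_p`, each an ISOMETRY by the uniqueness of the
  extension of `|·|_p` — campaign-S `norm_map_algHom` — and `ℚ̄_p` is ultrametric);
* `exists_retraction_of_not_dvd_finrank` — if `p ∤ [k' : k]` there is a `ℚ_p`-linear `r : k' → k` with
  `r ∘ σ = id` and `‖r z‖ ≤ ‖z‖` (the normalised trace; `‖[k':k]⁻¹‖ = 1`);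
* `logUnits_eq_ball_of_tame` — at a tame factor (`p > 2`, `e ≤ p − 2`) `log_p(R^×) = {z : ‖z‖ < 1} (= 𝔪)` ([IUTchIV]
  Prop. 1.2 (i) with `a = −b = 1/e`); hence `exists_logUnits_retraction_of_tame` — a norm-non-increasing retraction
  maps `log_p(R'^×)` into `log_p(R^×)` when both factors are tame;
* `exists_packetAlgHom_of_algHom` — the packet morphism `φ = ⊗σ_i` with `φ(ι_i(a)) = ι'_i(σ_i a)` EXISTS (Mathlib
  `PiTensorProduct.liftAlgHom`);
* **`packetLogμ_packetHull_orbit_slotUnion_le_of_tame_of_not_dvd`** — item (X) of abc-iut-w5-d166's G1-Θ memo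
  with NO residual hypothesis: `p > 2`, both tuples tame, `p ∤ [k'_i : σ_i k_i]` for every `i` ⇒
  `log μ̄(hull(⋃_γ γ·⋃_i ι_i(g_i)·(R_I)^∼)) ≤ log μ̄'(hull'(⋃_{γ'} γ'·⋃_i ι'_i(σ_i g_i)·(R'_I)^∼))`.

Classical local algebra; (Ind2)/the hull are the tree's typings of constructions of the disputed corpus [claim:
Mochizuki2012, status: disputed]; nothing here takes a side on [IUTchIII] Cor. 3.12; typed ≠ proved. PROOF-ONLY
file: no definitions, no `Prop` facts. [cite: NeukirchANT1999, Ch. II Thm. (4.8)] [cite: Mochizuki2012, IUTchIV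
Prop. 1.2 (i)(ii) p. 10, Thm 1.10 proof Step (v) p. 27–28] [cite: DupuyHilado2025, §4.7, §4.9, §4.12]
-/

noncomputable section

open Set Module
open scoped Pointwise TensorProduct

namespace Literature.IUT.LogVolume

/-! ## §1 The trace does not increase the norm -/

section Trace

variable {p : ℕ} [Fact p.Prime]
variable {k k' : Type} [NontriviallyNormedField k] [NormedAlgebra ℚ_[p] k] [IsUltrametricDist k] [ProperSpace k]
  [NontriviallyNormedField k'] [NormedAlgebra ℚ_[p] k'] [IsUltrametricDist k'] [ProperSpace k']

/-- **`‖Tr_{k'/k}(y)‖ ≤ ‖y‖`** for the `k`-algebra structure on `k'` given by a `ℚ_p`-algebra map `σ : k → k'`: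
`Tr(y) = Σ_τ τ(y)` over the `k`-embeddings `τ : k' → ℚ̄_p`, every `τ` (and `k → ℚ̄_p`) is an isometry, and `ℚ̄_p` is
ultrametric. [cite: NeukirchANT1999, Ch. II Thm. (4.8)] -/
theorem norm_trace_le (σ : k →ₐ[ℚ_[p]] k') (y : k') :
    letI := σ.toRingHom.toAlgebra
    ‖Algebra.trace k k' y‖ ≤ ‖y‖ := by
  letI : Algebra k k' := σ.toRingHom.toAlgebra
  haveI : IsScalarTower ℚ_[p] k k' := IsScalarTower.of_algebraMap_eq fun x => (σ.commutes x).symm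
  haveI : FiniteDimensional ℚ_[p] k := FiniteDimensional.of_locallyCompactSpace ℚ_[p]
  haveI : FiniteDimensional ℚ_[p] k' := FiniteDimensional.of_locallyCompactSpace ℚ_[p]
  haveI : FiniteDimensional k k' := Module.Finite.of_restrictScalars_finite ℚ_[p] k k'
  haveI : CharZero k := charZero_of_injective_algebraMap (algebraMap ℚ_[p] k).injective
  haveI : Algebra.IsSeparable k k' := Algebra.IsSeparable.of_integral k k'
  -- embed `k` into `ℚ̄_p`
  haveI : Algebra.IsAlgebraic ℚ_[p] k := Algebra.IsAlgebraic.of_finite ℚ_[p] k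
  let τ₀ : k →ₐ[ℚ_[p]] PadicAlgCl p := IsAlgClosed.lift
  letI : Algebra k (PadicAlgCl p) := τ₀.toRingHom.toAlgebra
  haveI : IsScalarTower ℚ_[p] k (PadicAlgCl p) := IsScalarTower.of_algebraMap_eq fun x => (τ₀.commutes x).symm
  have h := trace_eq_sum_embeddings (PadicAlgCl p) (K := k) (L := k') (x := y)
  have hτ₀ : ‖algebraMap k (PadicAlgCl p) (Algebra.trace k k' y)‖ = ‖Algebra.trace k k' y‖ :=
    norm_map_algHom τ₀ _
  rw [← hτ₀, h]
  refine IsUltrametricDist.norm_sum_le_of_forall_le_of_nonneg (norm_nonneg y) fun τ _ => ?_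
  exact (norm_map_algHom (τ.restrictScalars ℚ_[p]) y).le

/-- **The normalised trace is a norm-non-increasing `ℚ_p`-linear retraction** of an embedding `σ : k → k'` of
`p`-adic fields whose degree is prime to `p`: `∃ r : k' →ₗ[ℚ_p] k, r ∘ σ = id ∧ ‖r z‖ ≤ ‖z‖`
(`r = [k':k]⁻¹·Tr_{k'/k}`, `‖[k':k]⁻¹‖_p = 1`). [cite: NeukirchANT1999, Ch. II Thm. (4.8)] -/
theorem exists_retraction_of_not_dvd_finrank (σ : k →ₐ[ℚ_[p]] k')
    (hn : letI := σ.toRingHom.toAlgebra; ¬ p ∣ Module.finrank k k') :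
    ∃ r : k' →ₗ[ℚ_[p]] k, (∀ a, r (σ a) = a) ∧ ∀ z, ‖r z‖ ≤ ‖z‖ := by
  letI : Algebra k k' := σ.toRingHom.toAlgebra
  haveI : IsScalarTower ℚ_[p] k k' := IsScalarTower.of_algebraMap_eq fun x => (σ.commutes x).symm
  haveI : FiniteDimensional ℚ_[p] k' := FiniteDimensional.of_locallyCompactSpace ℚ_[p]
  haveI : FiniteDimensional k k' := Module.Finite.of_restrictScalars_finite ℚ_[p] k k'
  set n : ℕ := Module.finrank k k' with hndef
  have hn0 : n ≠ 0 := Module.finrank_pos.ne'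
  have hnQ : (n : ℚ_[p]) ≠ 0 := Nat.cast_ne_zero.mpr hn0
  have hnorm : ‖(n : ℚ_[p])‖ = 1 :=
    Padic.norm_natCast_eq_one_iff.mpr ((Nat.Prime.coprime_iff_not_dvd (Fact.out : p.Prime)).mpr hn)
  refine ⟨(n : ℚ_[p])⁻¹ • (Algebra.trace k k').restrictScalars ℚ_[p], fun a => ?_, fun z => ?_⟩
  · have hσ : σ a = algebraMap k k' a := rfl
    rw [LinearMap.smul_apply, LinearMap.restrictScalars_apply, hσ, Algebra.trace_algebraMap,
      ← Nat.cast_smul_eq_nsmul ℚ_[p], smul_smul, inv_mul_cancel₀ hnQ, one_smul]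
  · rw [LinearMap.smul_apply, LinearMap.restrictScalars_apply, norm_smul, norm_inv, hnorm, inv_one, one_mul]
    exact norm_trace_le σ z

variable (p) in
/-- **Tame ⇒ `log_p(R^×) = {z : ‖z‖ < 1}`** (`= 𝔪`): [IUTchIV] Prop. 1.2 (i) `p^a·R ⊆ log_p(R^×) ⊆ p^{−b}·R` with
`a = −b = 1/e` for `p > 2`, `e ≤ p − 2`, and `‖z‖ < 1 ⇔ ‖z‖ ≤ p^{−1/e}` by discreteness.
[cite: Mochizuki2012, IUTchIV Prop. 1.2 (i) p. 10] -/
theorem mem_logUnits_iff_norm_lt_one_of_tame (hp : 2 < p) (he : absRamificationIdx p k ≤ p - 2) (z : k) :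
    z ∈ logUnits k ↔ ‖z‖ < 1 := by
  have he1 := absRamificationIdx_pos p k
  have hp1 : (1 : ℝ) < p := by exact_mod_cast (Fact.out : p.Prime).one_lt
  have he0 : (0 : ℝ) < absRamificationIdx p k := by exact_mod_cast he1
  constructor
  · intro hz
    have h := logUnits_subset_pBall_neg_logRadiusB p k hz
    rw [mem_pBall_iff, logRadiusB_eq hp he1 he, neg_neg] at h
    refine h.trans_lt (Real.rpow_lt_one_of_one_lt_of_neg hp1 ?_)
    have : 0 < 1 / (absRamificationIdx p k : ℝ) := by positivity
    linarith
  · intro hz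
    refine pBall_logRadiusA_subset_logUnits p k ?_
    rw [mem_pBall_iff, logRadiusA_eq hp he1 he]
    exact norm_le_rpow_of_norm_lt_one p k hz

variable (p) in
/-- **Tame factors, degree prime to `p` ⇒ a `ℚ_p`-linear retraction of `σ` mapping `log_p(R'^×)` into `log_p(R^×)`**
(the normalised trace; both log-unit lattices are the open unit balls).
[cite: Mochizuki2012, IUTchIV Prop. 1.2 (i) p. 10] [cite: NeukirchANT1999, Ch. II Thm. (4.8)] -/
theorem exists_logUnits_retraction_of_tame (hp : 2 < p) (he : absRamificationIdx p k ≤ p - 2)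
    (he' : absRamificationIdx p k' ≤ p - 2) (σ : k →ₐ[ℚ_[p]] k')
    (hn : letI := σ.toRingHom.toAlgebra; ¬ p ∣ Module.finrank k k') :
    ∃ r : k' →ₗ[ℚ_[p]] k, (∀ a, r (σ a) = a) ∧ ∀ z, z ∈ logUnits k' → r z ∈ logUnits k := by
  obtain ⟨r, hr, hrn⟩ := exists_retraction_of_not_dvd_finrank σ hn
  refine ⟨r, hr, fun z hz => ?_⟩
  rw [mem_logUnits_iff_norm_lt_one_of_tame p hp he]
  rw [mem_logUnits_iff_norm_lt_one_of_tame p hp he'] at hz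
  exact (hrn z).trans_lt hz

end Trace

/-! ## §2 The packet morphism `⊗σ_i` exists; item (X) unconditionally at tame factors of degree prime to `p` -/

section Packet

variable (p : ℕ) [Fact p.Prime]
variable {I : Type} [Fintype I] [DecidableEq I] [Nonempty I]
variable (k : I → Type) [∀ i, NontriviallyNormedField (k i)] [∀ i, NormedAlgebra ℚ_[p] (k i)]
  [∀ i, IsUltrametricDist (k i)] [∀ i, ProperSpace (k i)]
variable (k' : I → Type) [∀ i, NontriviallyNormedField (k' i)] [∀ i, NormedAlgebra ℚ_[p] (k' i)]
  [∀ i, IsUltrametricDist (k' i)] [∀ i, ProperSpace (k' i)]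

omit [Fintype I] [Nonempty I] [∀ i, IsUltrametricDist (k i)] [∀ i, ProperSpace (k i)]
  [∀ i, IsUltrametricDist (k' i)] [∀ i, ProperSpace (k' i)] in
/-- **The packet morphism `φ = ⊗_i σ_i : ⊗_{ℚ_p} k_i → ⊗_{ℚ_p} k'_i` exists** as a `ℚ_p`-algebra homomorphism with
`φ(ι_i(a)) = ι'_i(σ_i a)` (Mathlib `PiTensorProduct.liftAlgHom` of `x ↦ ⊗ σ_i(x_i)`).
[cite: Mochizuki2012, IUTchIV Prop. 1.1 p. 9] -/
theorem exists_packetAlgHom_of_algHom (σ : ∀ i, k i →ₐ[ℚ_[p]] k' i) :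
    ∃ φ : PacketAlgebra p k →ₐ[ℚ_[p]] PacketAlgebra p k', ∀ (i : I) (a : k i), φ (iota p k i a) = iota p k' i (σ i a) := by
  let f : MultilinearMap ℚ_[p] k (PacketAlgebra p k') :=
    (PiTensorProduct.tprod ℚ_[p]).compLinearMap fun i => (σ i).toLinearMap
  have hf : ∀ x : Π i, k i, f x = PiTensorProduct.tprod ℚ_[p] (fun i => σ i (x i)) := fun x => rfl
  refine ⟨PiTensorProduct.liftAlgHom f ?_ ?_, fun i a => ?_⟩
  · rw [hf]
    have : (fun i => σ i ((1 : Π i, k i) i)) = 1 := funext fun i => by simp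
    rw [this]
    rfl
  · intro x y
    rw [hf, hf, hf, PiTensorProduct.tprod_mul_tprod]
    congr 1
    funext i
    exact map_mul (σ i) (x i) (y i)
  · rw [iota_eq_purePacket, iota_eq_purePacket, purePacket, purePacket, PiTensorProduct.liftAlgHom_apply,
      PiTensorProduct.lift.tprod, hf]
    congr 1
    funext j
    by_cases h : j = i
    · subst h; simp
    · simp [h]

/-- **Item (X) of the G1-Θ memo, UNCONDITIONALLY at tame factors of degree prime to `p`**: `p > 2`, `|I| ≥ 1`
nonempty, embeddings `σ_i : k_i → k'_i` of `p`-adic fields with every `k_i`, `k'_i` tame (`e ≤ p − 2`) and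
`p ∤ [k'_i : σ_i k_i]`, a packet morphism `φ` with `φ(ι_i(a)) = ι'_i(σ_i a)` (it exists,
`exists_packetAlgHom_of_algHom`), slot elements `g_i ∈ k_i^×`:
`log μ̄(hull(⋃_γ γ·⋃_i ι_i(g_i)·(R_I)^∼)) ≤ log μ̄'(hull'(⋃_{γ'} γ'·⋃_i ι'_i(σ_i g_i)·(R'_I)^∼))` — the normalised
log-volume of the (Ind2)-orbit hull of the (Ind1) slot-union does not decrease from the small fields to the big ones.
[cite: Mochizuki2012, IUTchIV Thm 1.10 proof Step (v) p. 27–28, Prop. 1.2 (i)(ii) p. 10] [cite: DupuyHilado2025, §4.7, §4.9, §4.12] -/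
theorem packetLogμ_packetHull_orbit_slotUnion_le_of_tame_of_not_dvd (hp : 2 < p)
    (he : ∀ i, absRamificationIdx p (k i) ≤ p - 2) (he' : ∀ i, absRamificationIdx p (k' i) ≤ p - 2)
    (σ : ∀ i, k i →ₐ[ℚ_[p]] k' i)
    (hn : ∀ i, letI := (σ i).toRingHom.toAlgebra; ¬ p ∣ Module.finrank (k i) (k' i))
    (φ : PacketAlgebra p k →ₐ[ℚ_[p]] PacketAlgebra p k')
    (hφ : ∀ (i : I) (a : k i), φ (iota p k i a) = iota p k' i (σ i a))
    (g : Π i, k i) (hg : ∀ i, g i ≠ 0) :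
    packetLogμ p k (packetHull p k
        (⋃ γ : indTwo p k, γ • ⋃ i, iota p k i (g i) • (normalizedPacket p k : Set (PacketAlgebra p k)))) ≤
      packetLogμ p k' (packetHull p k'
        (⋃ γ : indTwo p k', γ • ⋃ i, iota p k' i (σ i (g i)) •
          (normalizedPacket p k' : Set (PacketAlgebra p k')))) := by
  choose r hr hrΛ using fun i => exists_logUnits_retraction_of_tame p hp (he i) (he' i) (σ i) (hn i)
  exact packetLogμ_packetHull_orbit_slotUnion_le_of_retraction p k k' φ σ hφ r hr hrΛ g hg

omit [Fintype I] [Nonempty I] [∀ i, IsUltrametricDist (k i)] [∀ i, ProperSpace (k i)]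
  [∀ i, NontriviallyNormedField (k' i)] [∀ i, NormedAlgebra ℚ_[p] (k' i)] [∀ i, IsUltrametricDist (k' i)]
  [∀ i, ProperSpace (k' i)] in
/-- The slot-union depends on the slots only through their NORMS: if `‖g'_i‖ = ‖g_i‖` for every `i` (all nonzero)
then `⋃_i ι_i(g'_i)·(R_I)^∼ = ⋃_i ι_i(g_i)·(R_I)^∼` (`g'_i = g_i·u_i` with `‖u_i‖ = 1`, and `ι_i(u_i)` is a unit of
`(R_I)^∼`). [cite: DupuyHilado2025, §3.7, §4.7] -/
theorem iUnion_iota_smul_normalizedPacket_eq_of_norm_eq (g g' : Π i, k i) (hg : ∀ i, g i ≠ 0)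
    (hgg' : ∀ i, ‖g' i‖ = ‖g i‖) :
    (⋃ i, iota p k i (g' i) • (normalizedPacket p k : Set (PacketAlgebra p k))) =
      ⋃ i, iota p k i (g i) • (normalizedPacket p k : Set (PacketAlgebra p k)) := by
  refine Set.iUnion_congr fun i => ?_
  have hu : ‖g' i / g i‖ = 1 := by rw [norm_div, hgg' i, div_self (norm_ne_zero_iff.mpr (hg i))]
  have hgi : g' i = g i * (g' i / g i) := by rw [mul_div_cancel₀ _ (hg i)]
  rw [hgi, map_mul, mul_smul, iota_smul_normalizedPacket_eq_of_norm_eq_one p k i hu]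

/-- **Item (X), norm-matched form** (the shape the G1-Θ assembly consumes: the small-field and big-field Θ-values are
independent realisations with EQUAL NORMS, not images of one another): `p > 2`, tame tuples, `p ∤ [k'_i : σ_i k_i]`,
`φ(ι_i(a)) = ι'_i(σ_i a)`, `g_i ∈ k_i^×`, `g'_i ∈ k'_i` with `‖g'_i‖ = ‖g_i‖` ⇒
`log μ̄(hull(⋃_γ γ·⋃_i ι_i(g_i)·(R_I)^∼)) ≤ log μ̄'(hull'(⋃_{γ'} γ'·⋃_i ι'_i(g'_i)·(R'_I)^∼))`.
[cite: Mochizuki2012, IUTchIV Thm 1.10 proof Step (v) p. 27–28] [cite: DupuyHilado2025, §4.7, §4.9, §4.12] -/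
theorem packetLogμ_packetHull_orbit_slotUnion_le_of_tame_of_not_dvd_of_norm_eq (hp : 2 < p)
    (he : ∀ i, absRamificationIdx p (k i) ≤ p - 2) (he' : ∀ i, absRamificationIdx p (k' i) ≤ p - 2)
    (σ : ∀ i, k i →ₐ[ℚ_[p]] k' i)
    (hn : ∀ i, letI := (σ i).toRingHom.toAlgebra; ¬ p ∣ Module.finrank (k i) (k' i))
    (φ : PacketAlgebra p k →ₐ[ℚ_[p]] PacketAlgebra p k')
    (hφ : ∀ (i : I) (a : k i), φ (iota p k i a) = iota p k' i (σ i a))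
    (g : Π i, k i) (hg : ∀ i, g i ≠ 0) (g' : Π i, k' i) (hgg' : ∀ i, ‖g' i‖ = ‖g i‖) :
    packetLogμ p k (packetHull p k
        (⋃ γ : indTwo p k, γ • ⋃ i, iota p k i (g i) • (normalizedPacket p k : Set (PacketAlgebra p k)))) ≤
      packetLogμ p k' (packetHull p k'
        (⋃ γ : indTwo p k', γ • ⋃ i, iota p k' i (g' i) • (normalizedPacket p k' : Set (PacketAlgebra p k')))) := by
  have hσg : ∀ i, σ i (g i) ≠ 0 := fun i => (map_ne_zero (σ i)).mpr (hg i)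
  have hn' : ∀ i, ‖g' i‖ = ‖σ i (g i)‖ := fun i => by rw [hgg' i, norm_map_algHom (σ i) (g i)]
  rw [iUnion_iota_smul_normalizedPacket_eq_of_norm_eq p k' (fun i => σ i (g i)) g' hσg hn']
  exact packetLogμ_packetHull_orbit_slotUnion_le_of_tame_of_not_dvd p k k' hp he he' σ hn φ hφ g hg

end Packet

end Literature.IUT.LogVolume

end
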